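import Literature.Barriers.ValiantsHypothesis.BIJL18PermanentZeroFactorClosureProofs
import HarnessLib

/-!
# BIJL Thm. 6, completeness algebra over `𝔽_p`: small circuits for `Per_k mod p` from a vanishing
# integer multiple and Kaltofen's theorem AS TYPED (`BIJL2018_thm24`, existence half)

Topic `Barriers/ValiantsHypothesis`. Step (c) of the route of record to the LOAD-BEARING fact
`BIJL2018_thm6` (val-lit RULING (90)(a); memo `HOME/np/MEMO-p1g6-BIJL18-thm6-route.md`): the
`∃·BPP` machine of Bläser–Ikenmeyer–Jindal–Lysikov 2018, §6 never needs to RUN Kaltofen's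
factoring algorithm (Thm. 24) — it can GUESS a circuit for `Per_k` over `𝔽_p` (constants of
`log p` bits) and verify it; so only the EXISTENCE of such a circuit is needed, and that is exactly
the tree's typed fact `BIJL2018_thm24` (BIJL18PermanentZero.lean) applied with `e := 0`:

* `complexity_perPoly_zmod_le_of_thm24` — given `BIJL2018_thm24`, for every prime `p`, every
  `0 ≠ D ∈ ℤ[x_{11}, …, x_{kk}]` (`k = n + 1`) vanishing at all rational matrices of permanent zero,
  with `D mod p ≠ 0` and `deg D < p`:
  `L_{𝔽_p}(Per_k) ≤ (k² + τ(D) + deg D + log₂ p + 2)^κ` (`τ = constantFreeComplexity`), one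
  absolute `κ`. Proof = the printed steps 4–6 (ECCC pp. 18–19) with the factor GUESSED: over `𝔽_p`,
  `D = Per^j · h`, `Per ∤ h`, `1 ≤ j ≤ deg D < p` (`exists_eq_perPoly_pow_mul`,
  `perPoly_dvd_map_intCast_of_forall_permanent_eq_zero`), `Per` irreducible
  (`perPoly_irreducible`), and Thm. 24 at `f := D mod p`, `g := Per_k`, `e := 0`, `j`
  (transported to `Fin (k·k)` variables along `finProdFinEquiv`).
* `exists_complexity_perPoly_zmod_le` — the same from the typed hypothesis of Thm. 6,
  `HasVP0NaturalProofsAgainstPerZero` (`hasVP0NaturalProofsAgainstPerZero_iff_perPoly_dvd`), for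
  the natural-proof family `D` it provides.

What is NOT here: the choice of a good prime (`D mod p ≠ 0`, by counting primes against the height
of `D`), homogenisation to small FORMAL degree, the lift of an `𝔽_p`-circuit to an integer code,
the verifier machine and the `∃·BPP` assembly (bricks B4–B6 of the memo). Conditional on the
open named fact `BIJL2018_thm24` (taken as a hypothesis, never restated). Honest framing: a step
in formalising a 2018 conditional barrier theorem; nothing here bears on `VP ≠ VNP`, which is NOT
proved.

## References

* [BlaserIkenmeyerJindalLysikov2018] M. Bläser, C. Ikenmeyer, G. Jindal, V. Lysikov,
  *Generalized matrix completion and algebraic natural proofs*, STOC 2018 / ECCC TR18-064, §6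
  (Thm. 24; proof of Thm. 5 steps 4–6; proof of Thm. 6), pp. 18–19.
* [Kaltofen1989] E. Kaltofen, *Factorization of polynomials given by straight-line programs*,
  Randomness and Computation (1989), 375–412.
* [Vonzurgathen1987] J. von zur Gathen, *Permanent and determinant*, Linear Algebra Appl. 96
  (1987), Thm. 3.4 (irreducibility of the permanent).
-/

noncomputable section

namespace Literature.Barriers.ValiantsHypothesis

open MvPolynomial Literature.Computability.AlgebraicComplexity PerZeroDivisibility

/-- Base change does not increase the total degree (plumbing). [folklore] -/
private theorem totalDegree_map_le' {R S σ : Type*} [CommSemiring R] [CommSemiring S]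
    (f : R →+* S) (q : MvPolynomial σ R) : (map f q).totalDegree ≤ q.totalDegree :=
  Finset.sup_mono (support_map_subset f q)

/-- **Small circuits for `Per_k` over `𝔽_p` from a vanishing integer multiple, via Thm. 24 with
`e = 0`** (BIJL §6, steps 4–6 of the proof of Thm. 5 / proof of Thm. 6, with Kaltofen's algorithm
replaced by its existence statement): if `BIJL2018_thm24` holds then, for one absolute exponent
`κ`, for every prime `p` and every `D ∈ ℤ[x_{ij}]` (`(n+1) × (n+1)` variables) that vanishes at
every rational matrix of permanent zero, with `D mod p ≠ 0` and `deg D < p`,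
`L_{𝔽_p}(Per_{n+1}) ≤ ((n+1)² + τ(D) + deg D + log₂ p + 2)^κ`.
[cite: BlaserIkenmeyerJindalLysikov2018, §6 (Thm. 24 and proof of Thm. 5, steps 4–6)] locator: ECCC pp.18–19 -/
theorem complexity_perPoly_zmod_le_of_thm24 (h24 : BIJL2018_thm24) :
    ∃ κ : ℕ, ∀ (p : ℕ) [Fact p.Prime] (n : ℕ) (D : MvPolynomial (Fin (n + 1) × Fin (n + 1)) ℤ),
      map (Int.castRingHom (ZMod p)) D ≠ 0 →
      (∀ A : Matrix (Fin (n + 1)) (Fin (n + 1)) ℚ, A.permanent = 0 →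
        aeval (fun ij : Fin (n + 1) × Fin (n + 1) => A ij.1 ij.2) D = 0) →
      D.totalDegree < p →
      complexity (perPoly (Fin (n + 1)) (ZMod p)) ≤
        ((n + 1) * (n + 1) + constantFreeComplexity D + D.totalDegree + Nat.log 2 p + 2) ^ κ := by
  obtain ⟨κ, hκ⟩ := h24
  refine ⟨κ, fun p _ n D hne hD hdeg => ?_⟩
  -- over `𝔽_p`: `D = Per^j · h`, `Per ∤ h`, `1 ≤ j`, `j (n+1) ≤ deg D`
  set D' : MvPolynomial (Fin (n + 1) × Fin (n + 1)) (ZMod p) := map (Int.castRingHom (ZMod p)) D with hD'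
  set P : MvPolynomial (Fin (n + 1) × Fin (n + 1)) (ZMod p) := perPoly (Fin (n + 1)) (ZMod p) with hP
  have hdvd : P ∣ D' := perPoly_dvd_map_intCast_of_forall_permanent_eq_zero (ZMod p) D hD
  obtain ⟨j, h, hj1, hDe, hnd, hjdeg⟩ := exists_eq_perPoly_pow_mul hne (zSubst_eq_zero_of_perPoly_dvd hdvd)
  have hP0 : P ≠ 0 := perPoly_ne_zero _ _
  have hdegD' : D'.totalDegree ≤ D.totalDegree := totalDegree_map_le' _ _
  have hjp : j < p := by nlinarith
  have hpj : ¬ p ∣ j := Nat.not_dvd_of_pos_of_lt (by omega) hjp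
  -- transport to `Fin ((n+1)(n+1))` variables
  set e : Fin (n + 1) × Fin (n + 1) ≃ Fin ((n + 1) * (n + 1)) := finProdFinEquiv with he
  have hf0 : rename e D' ≠ 0 := (map_ne_zero_iff _ (rename_injective _ e.injective)).2 hne
  have hgirr : Irreducible (rename e P) := by
    have h1 : Irreducible P := perPoly_irreducible
    have h2 : rename e P = renameEquiv (ZMod p) e P := rfl
    rw [h2]
    exact (MulEquiv.irreducible_iff (renameEquiv (ZMod p) e : _ ≃ₐ[ZMod p] _).toMulEquiv).2 h1
  have hgdvd : rename e P ^ (p ^ 0 * j) ∣ rename e D' := by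
    rw [pow_zero, one_mul, ← map_pow]
    exact map_dvd _ ⟨h, hDe⟩
  have hgndvd : ¬ rename e P ^ (p ^ 0 * j + 1) ∣ rename e D' := by
    rw [pow_zero, one_mul]
    rintro hcontra
    -- pull back along the inverse renaming
    have hback : P ^ (j + 1) ∣ D' := by
      have h3 := map_dvd ((renameEquiv (ZMod p) e).symm.toRingEquiv.toRingHom) hcontra
      simpa [map_pow, AlgEquiv.symm_apply_apply, renameEquiv_apply] using h3
    rw [hDe, pow_succ] at hback
    exact hnd ((mul_dvd_mul_iff_left (pow_ne_zero j hP0)).1 hback)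
  have hk := hκ p ((n + 1) * (n + 1)) (rename e D') (rename e P) 0 j hf0 hgirr hpj hgdvd hgndvd
  rw [pow_zero, pow_one] at hk
  -- bookkeeping
  have hper : complexity (rename e P) = complexity P := complexity_renameEquiv_holds e P
  have hDe' : complexity (rename e D') = complexity D' := complexity_renameEquiv_holds e D'
  have h1 : complexity D' ≤ constantFreeComplexity D :=
    ArithCircuit.complexity_map_le_constantFreeComplexity _ _
  have h2 : (rename e D').totalDegree ≤ D.totalDegree := (totalDegree_rename_le _ _).trans hdegD'
  rw [hper] at hk
  refine hk.trans (Nat.pow_le_pow_left ?_ κ)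
  rw [hDe']
  omega

/-- **From the typed hypothesis of Thm. 6**: `VP⁰`-natural proofs against `{Per = 0}` give a
`VP⁰` family `D` of nonzero vanishing multiples (`hasVP0NaturalProofsAgainstPerZero_iff_perPoly_dvd`),
and, granted `BIJL2018_thm24`, small circuits for `Per_k` over every prime field in which `D_k`
survives and exceeds its degree: `L_{𝔽_p}(Per_k) ≤ (k² + τ(D_k) + deg D_k + log₂ p + 2)^κ`. The
size `τ(D_k)` and the degree are p-bounded (`IsVP0Family.isPBounded_constantFreeComplexity`,
`IsVP0Family.isPFamily`). [cite: BlaserIkenmeyerJindalLysikov2018, §6 (proof of Thm. 6)] locator: ECCC p.19 -/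
theorem exists_complexity_perPoly_zmod_le (h6 : HasVP0NaturalProofsAgainstPerZero)
    (h24 : BIJL2018_thm24) :
    ∃ (D : ∀ n : ℕ, MvPolynomial (Fin n × Fin n) ℤ) (κ : ℕ), IsVP0Family D ∧ (∀ n, D n ≠ 0) ∧
      ∀ (p : ℕ) [Fact p.Prime] (n : ℕ), map (Int.castRingHom (ZMod p)) (D (n + 1)) ≠ 0 →
        (D (n + 1)).totalDegree < p →
        complexity (perPoly (Fin (n + 1)) (ZMod p)) ≤
          ((n + 1) * (n + 1) + constantFreeComplexity (D (n + 1)) + (D (n + 1)).totalDegree +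
            Nat.log 2 p + 2) ^ κ := by
  obtain ⟨D, hVP, hD⟩ := h6
  obtain ⟨κ, hκ⟩ := complexity_perPoly_zmod_le_of_thm24 h24
  exact ⟨D, κ, hVP, fun n => (hD n).1, fun p _ n hne hdeg => hκ p n (D (n + 1)) hne (hD (n + 1)).2 hdeg⟩

end Literature.Barriers.ValiantsHypothesis

end
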